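import Literature.NumberTheory.Automorphic.BianchiCuspDepth
import Mathlib.RingTheory.DedekindDomain.Ideal.Basic
import Mathlib.RingTheory.ClassGroup.Basic
import Mathlib.NumberTheory.NumberField.ClassNumber
import HarnessLib

/-!
# Cusps of Bianchi groups: unimodular completion, transitivity and finiteness of ideal classes

Topic `NumberTheory/Automorphic`; namespace `Literature.NumberTheory.Automorphic`, grouping
sub-namespace `BianchiCusp`.  Theorems only (no definition, no `sorry`); sequel of
`BianchiCuspDepth`.

The classical description of the cusps of `GL₂(𝓞_K)` by ideal classes
([ElstrodtGrunewaldMennicke1998, Ch. 7 §7.2, Thm. 2.4: the cusps of `PSL₂(𝓞_K)` are in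
bijection with the ideal class group]; [Swan1971, §3]):

* `exists_det_eq_one_of_mem_inv` — **unimodular completion over the inverse ideal**: for
  `v = (a, b) ≠ 0` with `𝔞 = (a, b)` there are `c, d ∈ 𝔞⁻¹` with `a d - b c = 1`
  (`1 ∈ 𝔞 𝔞⁻¹ = a 𝔞⁻¹ + b 𝔞⁻¹`);
* `exists_mulVec_eq_of_idealOf_eq` — **transitivity**: two integral vectors generating the SAME
  ideal are related by an element of `GL₂(𝓞_K)` (indeed of `SL₂`): `γ = M_w M_v⁻¹` with
  `M_v = (a c; b d)`, all entries of `γ` lying in `𝔞 𝔞⁻¹ = 𝓞_K`;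
* `exists_reduced_representatives` — **finitely many cusp classes up to scalars**: there is a
  finite set `S` of integral vectors such that every non-zero `v ∈ 𝓞_K²` satisfies
  `x v = y (γ w)` for some `w ∈ S`, `γ ∈ GL₂(𝓞_K)` and non-zero `x, y ∈ 𝓞_K` (finiteness of
  the class group, Mathlib `ClassGroup.mk0_eq_mk0_iff`), together with the scalar-only form
  `exists_scaled_eq_of_classes` (`x v = y w` with `𝔞_w` in a finite set of ideals);
* the cusp-equivalence relation itself and pairwise inequivalent representatives are in
  `BianchiCuspClasses` (after the definition `CuspRel` of `BianchiCuspCoordinates`).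

## References

* J. Elstrodt, F. Grunewald, J. Mennicke, *Groups Acting on Hyperbolic Space* (1998), Ch. 7
  §7.2 Thm. 2.4 [ElstrodtGrunewaldMennicke1998].
* R. G. Swan, Adv. Math. 6 (1971), §3 [Swan1971].
-/

noncomputable section

open Matrix NumberField
open scoped MatrixGroups nonZeroDivisors

namespace Literature.NumberTheory.Automorphic

namespace BianchiCusp

variable {K : Type*} [Field K] [NumberField K]

/-! ### Unimodular completion -/

omit [NumberField K] in
/-- The ideal of a non-zero vector as a non-zero-divisor of the monoid of ideals. [folklore] -/
theorem idealOf_mem_nonZeroDivisors {v : OVec K} (hv : v ≠ 0) : idealOf v ∈ (Ideal (𝓞 K))⁰ := by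
  rw [mem_nonZeroDivisors_iff_ne_zero, Ne, Submodule.zero_eq_bot, idealOf_eq_bot_iff]
  exact hv

/-- **Unimodular completion**: for `v = (a, b) ≠ 0` there are `c, d ∈ K` in the inverse of
`𝔞_v = (a, b)` (as a fractional ideal) with `a d - b c = 1`. [cite: ElstrodtGrunewaldMennicke1998, Ch. 7 §7.2] -/
theorem exists_det_eq_one_of_mem_inv {v : OVec K} (hv : v ≠ 0) :
    ∃ c d : K, c ∈ ((idealOf v : FractionalIdeal (𝓞 K)⁰ K))⁻¹ ∧
      d ∈ ((idealOf v : FractionalIdeal (𝓞 K)⁰ K))⁻¹ ∧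
      (v 0 : K) * d - (v 1 : K) * c = 1 := by
  set I : FractionalIdeal (𝓞 K)⁰ K := ((idealOf v : Ideal (𝓞 K)) : FractionalIdeal (𝓞 K)⁰ K) with hI
  have hI0 : I ≠ 0 := by
    rw [hI, Ne, FractionalIdeal.coeIdeal_eq_zero]
    exact fun h => hv ((idealOf_eq_bot_iff v).1 h)
  have h1 : (1 : K) ∈ I * I⁻¹ := by
    rw [mul_inv_cancel₀ hI0]
    exact (FractionalIdeal.mem_one_iff _).2 ⟨1, map_one _⟩
  -- `↑(I * I⁻¹) = (a) I⁻¹ ⊔ (b) I⁻¹` as submodules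
  have hcoe : ((I * I⁻¹ : FractionalIdeal (𝓞 K)⁰ K) : Submodule (𝓞 K) K) =
      Submodule.span (𝓞 K) {(v 0 : K)} * (I⁻¹ : FractionalIdeal (𝓞 K)⁰ K) ⊔
        Submodule.span (𝓞 K) {(v 1 : K)} * (I⁻¹ : FractionalIdeal (𝓞 K)⁰ K) := by
    rw [FractionalIdeal.coe_mul, hI, FractionalIdeal.coe_coeIdeal, idealOf,
      IsLocalization.coeSubmodule_span, Set.image_pair, Submodule.span_insert, Submodule.sup_mul]
  have h1' : (1 : K) ∈ ((I * I⁻¹ : FractionalIdeal (𝓞 K)⁰ K) : Submodule (𝓞 K) K) := h1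
  rw [hcoe, Submodule.mem_sup] at h1'
  obtain ⟨y, hy, z, hz, hyz⟩ := h1'
  obtain ⟨d, hd, rfl⟩ := Submodule.mem_span_singleton_mul.1 hy
  obtain ⟨c, hc, rfl⟩ := Submodule.mem_span_singleton_mul.1 hz
  refine ⟨-c, d, ?_, hd, ?_⟩
  · exact Submodule.neg_mem _ hc
  · rw [mul_neg, sub_neg_eq_add]
    exact hyz

/-- Products of elements of `𝔞_v` and of `𝔞_v⁻¹` are algebraic integers. [folklore] -/
theorem exists_eq_mul_of_mem_inv {v : OVec K} {x : 𝓞 K} (hx : x ∈ idealOf v) {c : K}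
    (hc : c ∈ ((idealOf v : FractionalIdeal (𝓞 K)⁰ K))⁻¹) : ∃ r : 𝓞 K, (r : K) = (x : K) * c := by
  by_cases hv : v = 0
  · subst hv
    have : x = 0 := by
      have h := hx
      rw [(idealOf_eq_bot_iff (0 : OVec K)).2 rfl, Ideal.mem_bot] at h
      exact h
    exact ⟨0, by simp [this]⟩
  set I : FractionalIdeal (𝓞 K)⁰ K := ((idealOf v : Ideal (𝓞 K)) : FractionalIdeal (𝓞 K)⁰ K) with hI
  have hI0 : I ≠ 0 := by
    rw [hI, Ne, FractionalIdeal.coeIdeal_eq_zero]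
    exact fun h => hv ((idealOf_eq_bot_iff v).1 h)
  have hxI : (x : K) ∈ I := by
    rw [hI, FractionalIdeal.mem_coeIdeal]
    exact ⟨x, hx, rfl⟩
  have hmem : (x : K) * c ∈ I * I⁻¹ := FractionalIdeal.mul_mem_mul hxI hc
  rw [mul_inv_cancel₀ hI0, FractionalIdeal.mem_one_iff (𝓞 K)⁰] at hmem
  obtain ⟨r, hr⟩ := hmem
  exact ⟨r, hr⟩

/-! ### Transitivity on vectors with the same ideal -/

/-- **Transitivity**: integral vectors generating the same ideal are related by `GL₂(𝓞_K)`
(by an element of determinant `1`). [cite: ElstrodtGrunewaldMennicke1998, Ch. 7 §7.2 Thm. 2.4] -/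
theorem exists_mulVec_eq_of_idealOf_eq {v w : OVec K} (hv : v ≠ 0) (hvw : idealOf v = idealOf w) :
    ∃ γ : GL (Fin 2) (𝓞 K), (γ : Matrix (Fin 2) (Fin 2) (𝓞 K)).det = 1 ∧
      (γ : Matrix (Fin 2) (Fin 2) (𝓞 K)) *ᵥ v = w := by
  obtain ⟨c, d, hc, hd, h1⟩ := exists_det_eq_one_of_mem_inv hv
  have hw : w ≠ 0 := by
    intro h
    rw [h, (idealOf_eq_bot_iff (0 : OVec K)).2 rfl, idealOf_eq_bot_iff] at hvw
    exact hv hvw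
  obtain ⟨c', d', hc', hd', h1'⟩ := exists_det_eq_one_of_mem_inv hw
  -- inverse-ideal membership for `w` transported to `v`
  rw [← hvw] at hc' hd'
  -- the matrix over `K`: `M_w * adj(M_v)`
  set a : K := ((v 0 : 𝓞 K) : K)
  set b : K := ((v 1 : 𝓞 K) : K)
  set a' : K := ((w 0 : 𝓞 K) : K)
  set b' : K := ((w 1 : 𝓞 K) : K)
  let G : Matrix (Fin 2) (Fin 2) K := !![a' * d - c' * b, -(a' * c) + c' * a; b' * d - d' * b, -(b' * c) + d' * a]
  -- all entries are integral
  have hw0 : w 0 ∈ idealOf v := hvw ▸ apply_mem_idealOf w 0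
  have hw1 : w 1 ∈ idealOf v := hvw ▸ apply_mem_idealOf w 1
  have hent : ∀ i j, ∃ r : 𝓞 K, (r : K) = G i j := by
    intro i j
    obtain ⟨r1, hr1⟩ := exists_eq_mul_of_mem_inv hw0 hd
    obtain ⟨r2, hr2⟩ := exists_eq_mul_of_mem_inv (apply_mem_idealOf v 1) hc'
    obtain ⟨r3, hr3⟩ := exists_eq_mul_of_mem_inv hw0 hc
    obtain ⟨r4, hr4⟩ := exists_eq_mul_of_mem_inv (apply_mem_idealOf v 0) hc'
    obtain ⟨r5, hr5⟩ := exists_eq_mul_of_mem_inv hw1 hd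
    obtain ⟨r6, hr6⟩ := exists_eq_mul_of_mem_inv (apply_mem_idealOf v 1) hd'
    obtain ⟨r7, hr7⟩ := exists_eq_mul_of_mem_inv hw1 hc
    obtain ⟨r8, hr8⟩ := exists_eq_mul_of_mem_inv (apply_mem_idealOf v 0) hd'
    fin_cases i <;> fin_cases j
    · refine ⟨r1 - r2, ?_⟩
      change ((r1 - r2 : 𝓞 K) : K) = a' * d - c' * b
      rw [RingOfIntegers.coe_eq_algebraMap, map_sub, ← RingOfIntegers.coe_eq_algebraMap,
        ← RingOfIntegers.coe_eq_algebraMap, hr1, hr2]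
      ring
    · refine ⟨-r3 + r4, ?_⟩
      change ((-r3 + r4 : 𝓞 K) : K) = -(a' * c) + c' * a
      rw [RingOfIntegers.coe_eq_algebraMap, map_add, map_neg, ← RingOfIntegers.coe_eq_algebraMap,
        ← RingOfIntegers.coe_eq_algebraMap, hr3, hr4]
      ring
    · refine ⟨r5 - r6, ?_⟩
      change ((r5 - r6 : 𝓞 K) : K) = b' * d - d' * b
      rw [RingOfIntegers.coe_eq_algebraMap, map_sub, ← RingOfIntegers.coe_eq_algebraMap,
        ← RingOfIntegers.coe_eq_algebraMap, hr5, hr6]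
      ring
    · refine ⟨-r7 + r8, ?_⟩
      change ((-r7 + r8 : 𝓞 K) : K) = -(b' * c) + d' * a
      rw [RingOfIntegers.coe_eq_algebraMap, map_add, map_neg, ← RingOfIntegers.coe_eq_algebraMap,
        ← RingOfIntegers.coe_eq_algebraMap, hr7, hr8]
      ring
  choose r hr using hent
  let R : Matrix (Fin 2) (Fin 2) (𝓞 K) := Matrix.of r
  have hRmap : (algebraMap (𝓞 K) K).mapMatrix R = G := by
    ext i j
    exact hr i j
  -- determinant `1`
  have hdetG : G.det = 1 := by
    simp only [G, det_fin_two_of]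
    linear_combination (a' * d' - b' * c') * h1 + h1'
  have hdetR : R.det = 1 := by
    apply IsFractionRing.injective (𝓞 K) K
    rw [map_one, RingHom.map_det, hRmap, hdetG]
  -- `G v = w`
  have hGv : G *ᵥ (fun i => (v i : K)) = fun i => (w i : K) := by
    funext i
    fin_cases i
    · simp only [G, mulVec, dotProduct, Fin.sum_univ_two, of_apply, cons_val', cons_val_zero,
        cons_val_one, empty_val', cons_val_fin_one]
      change (a' * d - c' * b) * a + (-(a' * c) + c' * a) * b = a'
      linear_combination a' * h1
    · simp only [G, mulVec, dotProduct, Fin.sum_univ_two, of_apply, cons_val', cons_val_zero,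
        cons_val_one, empty_val', cons_val_fin_one]
      change (b' * d - d' * b) * a + (-(b' * c) + d' * a) * b = b'
      linear_combination b' * h1
  refine ⟨Matrix.SpecialLinearGroup.toGL (⟨R, hdetR⟩ : SpecialLinearGroup (Fin 2) (𝓞 K)), ?_, ?_⟩
  · exact hdetR
  · rw [Matrix.SpecialLinearGroup.coe_GL_coe_matrix]
    funext i
    apply IsFractionRing.injective (𝓞 K) K
    have h := congrFun hGv i
    have hfun : (fun i => ((v i : 𝓞 K) : K)) = (algebraMap (𝓞 K) K) ∘ v := rfl
    rw [← hRmap, hfun, RingHom.mapMatrix_apply, ← RingHom.map_mulVec] at h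
    exact h

/-! ### Finitely many cusp classes -/

/-- The class of `𝔞_v`. [folklore] -/
theorem exists_scaled_of_mk0_eq {v u : OVec K} (hv : v ≠ 0) (hu : u ≠ 0)
    (h : ClassGroup.mk0 ⟨idealOf v, idealOf_mem_nonZeroDivisors hv⟩ =
      ClassGroup.mk0 ⟨idealOf u, idealOf_mem_nonZeroDivisors hu⟩) :
    ∃ (w : OVec K) (x y : 𝓞 K), x ≠ 0 ∧ y ≠ 0 ∧ x • v = y • w ∧ idealOf w = idealOf u := by
  rw [ClassGroup.mk0_eq_mk0_iff] at h
  obtain ⟨x, y, hx, hy, hxy⟩ := h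
  change Ideal.span {x} * idealOf v = Ideal.span {y} * idealOf u at hxy
  have hmem : ∀ i, ∃ r ∈ idealOf u, y * r = x * v i := fun i => by
    have : x * v i ∈ Ideal.span {y} * idealOf u := by
      rw [← hxy]
      exact Ideal.mul_mem_mul (Ideal.mem_span_singleton_self x) (apply_mem_idealOf v i)
    exact Ideal.mem_span_singleton_mul.1 this
  choose r hr hyr using hmem
  refine ⟨r, x, y, hx, hy, ?_, ?_⟩
  · funext i
    simp only [Pi.smul_apply, smul_eq_mul]
    exact (hyr i).symm
  · apply (Ideal.span_singleton_mul_right_inj hy).1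
    rw [← idealOf_smul, show y • r = x • v from funext fun i => by simp [hyr i], idealOf_smul, hxy]

/-- **Finitely many cusp classes up to scalars (ideal form)**: a finite set of ideals such that
every non-zero `v` is a scalar modification `x v = y w` of a vector `w` whose ideal lies in it.
[cite: ElstrodtGrunewaldMennicke1998, Ch. 7 §7.2 Thm. 2.4] -/
theorem exists_scaled_eq_of_classes :
    ∃ S : Finset (OVec K), (∀ u ∈ S, u ≠ 0) ∧ ∀ v : OVec K, v ≠ 0 →
      ∃ u ∈ S, ∃ (w : OVec K) (x y : 𝓞 K), x ≠ 0 ∧ y ≠ 0 ∧ x • v = y • w ∧ idealOf w = idealOf u := by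
  classical
  -- one representative vector per attained class
  let cl : {v : OVec K // v ≠ 0} → ClassGroup (𝓞 K) := fun v =>
    ClassGroup.mk0 ⟨idealOf v.1, idealOf_mem_nonZeroDivisors v.2⟩
  have hrep : ∀ c : Set.range cl, ∃ v : {v : OVec K // v ≠ 0}, cl v = c := fun c => c.2
  choose rep hrep using hrep
  refine ⟨Finset.univ.image fun c : Set.range cl => (rep c).1, ?_, ?_⟩
  · intro u hu
    obtain ⟨c, -, rfl⟩ := Finset.mem_image.1 hu
    exact (rep c).2
  · intro v hv
    let c : Set.range cl := ⟨cl ⟨v, hv⟩, ⟨_, rfl⟩⟩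
    refine ⟨(rep c).1, Finset.mem_image.2 ⟨c, Finset.mem_univ _, rfl⟩, ?_⟩
    have hc : cl ⟨v, hv⟩ = cl (rep c) := by rw [hrep c]
    exact exists_scaled_of_mk0_eq hv (rep c).2 hc

/-- **Finitely many cusp classes** (group form): a finite set `S` of non-zero integral vectors
such that for every non-zero `v` there are `u ∈ S`, `γ ∈ GL₂(𝓞_K)` and non-zero scalars with
`x v = y (γ u)` — the cusps of `GL₂(𝓞_K)` are finite in number.
[cite: ElstrodtGrunewaldMennicke1998, Ch. 7 §7.2 Thm. 2.4] -/
theorem exists_reduced_representatives :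
    ∃ S : Finset (OVec K), (∀ u ∈ S, u ≠ 0) ∧ ∀ v : OVec K, v ≠ 0 →
      ∃ u ∈ S, ∃ (γ : GL (Fin 2) (𝓞 K)) (x y : 𝓞 K), x ≠ 0 ∧ y ≠ 0 ∧
        x • v = y • ((γ : Matrix (Fin 2) (Fin 2) (𝓞 K)) *ᵥ u) := by
  obtain ⟨S, hS, h⟩ := exists_scaled_eq_of_classes (K := K)
  refine ⟨S, hS, fun v hv => ?_⟩
  obtain ⟨u, hu, w, x, y, hx, hy, hxy, hwu⟩ := h v hv
  obtain ⟨γ, -, hγ⟩ := exists_mulVec_eq_of_idealOf_eq (hS u hu) hwu.symm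
  exact ⟨u, hu, γ, x, y, hx, hy, by rw [hγ, hxy]⟩

end BianchiCusp

end Literature.NumberTheory.Automorphic
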